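import Mathlib.SetTheory.Ordinal.Rank
import Literature.Order.Ordinal.NaturalSum
import HarnessLib

/-!
# Brookfield's length function: `λ_X` is the least isotone map, `len((α + 1) × (β + 1)) = α ⊕ β`, and `⊕` is associative
# (Clark 2015, §1.1–§1.2)

Topic `Literature/Order/Ordinal`, namespace `Literature.Order.Ordinal`.  THEOREMS ONLY (no `def`, no instance, no named fact),
all proved.  Clark's length function `λ_X : X → Ord` of an Artinian ordered set `X` IS Mathlib's `IsWellFounded.rank (· < ·)`
(«the smallest ordinal greater than the ranks of all elements below it» — the transfinite construction of Thm. 2); this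
file says so in Clark's terms and identifies the tree's natural sum `nadd` (`NaturalSum.lean`, defined by the Brookfield
recursion) with the length of the rectangle `(α + 1) × (β + 1)`, which is Brookfield's DEFINITION of `α ⊕_B β`.

## Source (read at the page)

P. L. Clark, *A note on Euclidean order types*, Order **32** (2015) 157–178 [Clark2015EuclideanOrderTypes] (materialised
`paper:arxiv-1208.0977`, arXiv numbering; `p0003.txt`), §1, VERBATIM.  §1.1: «A map `f : X → Y` is weakly isotone (resp.
isotone) if `x₁ ≤ x₂ ∈ X ⟹ f(x₁) ≤ f(x₂)` (resp. `x₁ < x₂ ⟹ f(x₁) < f(x₂)`). … An ordered class `X` is Noetherian (resp.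
Artinian) if there is no isotone map `f : ℤ⁺ → X` (resp. `f : ℤ⁻ → X`). … For an ordered set `X`, we define `Iso(X) ⊂ Ord^X`
to be the subclass of isotone maps.  **Lemma 1.** Let `X` be an ordered set. Then every nonempty subclass of `Iso(X)` has an
infimum in `Iso(X)`. Proof. … If `x < y` in `X`, then `f_i(x) < f_i(y)` for all `i ∈ I`, so
`f(x) = min_i f_i(x) < min_i (f_i(x) + 1) ≤ min_i f_i(y) = f(y)`.  **Theorem 2.** For a downward small ordered class `X`,
TFAE: (i) There is an isotone map `f : X → Ord`. (ii) There is an Artinian ordered set `Y` and an isotone map `f : X → Y`.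
(iii) `X` is Artinian.»  §1.2: «for any Artinian ordered set `X`, `Iso(X)` has a bottom element. Indeed the map
`λ_X : X → Ord` constructed in the proof of Theorem 2 is the bottom element of `Iso(X)`. Following [Brookfield02], we call
`λ_X` the length function.  If `X` has a top element `T`, we define the length of `X` to be `len(X) = λ_X(T)`.
**Example 1.1:** For `α ∈ Ord` and `x ≤ α`, `λ_{α+1}(x) = x`, so `len(α + 1) = λ_{α+1}(α) = α`.  **Example 1.2:** For
`m, n ∈ ℤ⁺`, let `X₁ = {0, …, m}` and `X₂ = {0, …, n}`, and let `X = X₁ × X₂`. Then for all `(i, j) ∈ X`, `λ_X(i, j) = i + j`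
and `len(X) = m + n`.  For `α, β ∈ Ord`, we define the Brookfield sum `α ⊕_B β := len((α + 1) × (β + 1))`. … This operation
is well-known to the initiates of ordinal arithmetic, who call it the “natural sum”.»

## What is formalised

* §1 (`X` a preorder with well-founded `<` = «Artinian ordered set»; `λ_X = IsWellFounded.rank (· < ·)`, isotone by Mathlib's
  `WellFoundedLT.rank_strictMono`): **`rank_le_of_strictMono`** («`λ_X` is the bottom element of `Iso(X)`»), `strictMono_iInf`
  (Lemma 1), `wellFoundedLT_iff_exists_strictMono` (Thm. 2, (i) ⟺ (iii), for sets), `rank_subtype_eq_of_isLowerSet`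
  (`λ_D = λ_X|_D` on a down-set `D`, so `len(D(x)) = λ_X(x)`), **Example 1.1** `rank_ordinal_eq_lift` (`λ_Ord(x) = x`) and
  `rank_Iic_ordinal_top` (`len(α + 1) = α`).
* §2 **Brookfield's sum is the tree's `nadd`**: `rank_prod_eq_lift_nadd` (`λ_{Ord × Ord}(α, β) = α ⊕ β`) and
  **`rank_Iic_prod_top`** (`len((α + 1) × (β + 1)) = α ⊕ β`, the definition of `⊕_B`, with `(α + 1) × (β + 1)` the down-set
  of `(α, β)` in `Ord × Ord`); **Example 1.2** `rank_nat_prod` (`λ_{ℕ × ℕ}(i, j) = i + j`).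
  Universe note: `Ord × Ord` (universe `u`) lives in `Type (u+1)`, so its rank takes values in `Ordinal.{u+1}` and the
  identification reads `λ(α, β) = lift (α ⊕ β)`.
* §3 **`nadd_assoc`** (`(α ⊕ β) ⊕ γ = α ⊕ (β ⊕ γ)`, resolving a `TODO(general form)` of `NaturalSum.lean`), `nadd_left_comm`,
  `nadd_right_comm`.
-- TODO(general form): Clark's Thm. 3 (`⊕_B = ⊕_H`, the Cantor-normal-form description) and Prop. 4 (b)'s upper bound remain open
-- in the tree (see `NaturalSum.lean`).

## Mathlib / tree search

Mathlib: `IsWellFounded.rank`, `IsWellFounded.rank_eq` (`rank x = ⨆_{y<x} succ (rank y)`), `IsWellFounded.rank_lt_of_rel`,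
`WellFoundedLT.rank_strictMono`, `IsWellFounded.rank_eq_typein`, `Ordinal.typein_ordinal`, `StrictMono.wellFoundedLT`,
`ciInf_mem`, `ciInf_le'`, `Prod.wellFoundedLT`, `Ordinal.le_lift_iff`, `Ordinal.iSup_le`, `Ordinal.le_iSup`; Mathlib at this pin
has no `Ordinal.nadd` (see `NaturalSum.lean`).  Tree: `NaturalSum.lean` (`nadd`, `nadd_def`, `lt_nadd_iff`, `nadd_le_iff`,
`nadd_strictMono`, `nadd_le_of_isotone`, `nadd_comm`, `nadd_natCast_natCast`); `rg "IsWellFounded.rank" Literature` → nothing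
before this file.
-/

namespace Literature.Order.Ordinal

open _root_.Ordinal _root_.Order

universe u v

/-! ## §1 The length function `λ_X = rank` of an Artinian ordered set -/

section LengthFunction

variable {X : Type u} [Preorder X] [WellFoundedLT X]

/-- **«`λ_X` is the bottom element of `Iso(X)`»**: every isotone (= strictly monotone) `f : X → Ord` dominates the length
function `λ_X = rank`. [cite: Clark2015EuclideanOrderTypes, §1.2 (length function) and Thm. 2] -/
theorem rank_le_of_strictMono {f : X → Ordinal.{u}} (hf : StrictMono f) (x : X) :
    IsWellFounded.rank (· < ·) x ≤ f x := by
  induction x using WellFoundedLT.induction with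
  | ind x ih =>
    rw [IsWellFounded.rank_eq]
    exact Ordinal.iSup_le fun y ↦ succ_le_of_lt ((ih y.1 y.2).trans_lt (hf y.2))

/-- **Lemma 1**: the pointwise infimum of a non-empty family of isotone maps `X → Ord` is isotone
(«`f(x) = min_i f_i(x) < min_i (f_i(x) + 1) ≤ min_i f_i(y) = f(y)`»). [cite: Clark2015EuclideanOrderTypes, Lemma 1] -/
theorem strictMono_iInf {ι : Type v} [Nonempty ι] {Y : Type*} [Preorder Y] {f : ι → Y → Ordinal.{u}}
    (hf : ∀ i, StrictMono (f i)) : StrictMono fun y ↦ ⨅ i, f i y := by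
  intro y₁ y₂ h
  obtain ⟨i, hi⟩ := ciInf_mem fun i ↦ f i y₂
  calc ⨅ i, f i y₁ ≤ f i y₁ := ciInf_le' _ i
    _ < f i y₂ := hf i h
    _ = ⨅ i, f i y₂ := hi

/-- **Thm. 2, (i) ⟺ (iii)** (for ordered sets): `X` is Artinian iff it admits an isotone map to `Ord` (one direction is
`λ_X`, the other: an isotone image of a strictly decreasing sequence would strictly decrease in `Ord`).
[cite: Clark2015EuclideanOrderTypes, Thm. 2] -/
theorem wellFoundedLT_iff_exists_strictMono {Y : Type u} [Preorder Y] :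
    WellFoundedLT Y ↔ ∃ f : Y → Ordinal.{u}, StrictMono f :=
  ⟨fun _ ↦ ⟨_, WellFoundedLT.rank_strictMono⟩, fun ⟨_, hf⟩ ↦ hf.wellFoundedLT⟩

/-- The length function of a down-set `D ⊆ X` is the restriction of `λ_X` (the recursion only looks below `x`); in
particular `len(D(x)) = λ_X(x)` for the principal down-set `D(x) = {y | y ≤ x}`. [cite: Clark2015EuclideanOrderTypes, §1.2
(`len(X) = λ_X(T)`) and Thm. 2 (proof)] -/
theorem rank_subtype_eq_of_isLowerSet {s : Set X} (hs : IsLowerSet s) (x : s) :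
    IsWellFounded.rank (α := s) (· < ·) x = IsWellFounded.rank (α := X) (· < ·) x.1 := by
  obtain ⟨x, hx⟩ := x
  induction x using WellFoundedLT.induction with
  | ind x ih =>
    rw [IsWellFounded.rank_eq, IsWellFounded.rank_eq]
    apply le_antisymm
    · refine Ordinal.iSup_le fun y ↦ ?_
      rw [ih y.1.1 y.2 y.1.2]
      exact Ordinal.le_iSup (fun b : {b // b < x} ↦ succ (IsWellFounded.rank (· < ·) b.1)) ⟨y.1.1, y.2⟩
    · refine Ordinal.iSup_le fun b ↦ ?_
      have hb : b.1 ∈ s := hs b.2.le hx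
      rw [← ih b.1 b.2 hb]
      exact Ordinal.le_iSup (fun y : {y : s // y < ⟨x, hx⟩} ↦ succ (IsWellFounded.rank (· < ·) y.1)) ⟨⟨b.1, hb⟩, b.2⟩

/-- **Example 1.1 «`λ_{α+1}(x) = x`»**: on the ordinals themselves the length function is the identity (up to the universe
lift `Ordinal.{u} → Ordinal.{u+1}` forced by `Ord` being a proper class). [cite: Clark2015EuclideanOrderTypes, Example 1.1] -/
theorem rank_ordinal_eq_lift (a : Ordinal.{u}) : IsWellFounded.rank (· < ·) a = lift.{u + 1} a := by
  rw [IsWellFounded.rank_eq_typein]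
  exact typein_ordinal a

/-- **Example 1.1 «`len(α + 1) = λ_{α+1}(α) = α`»** (`α + 1 = {x | x ≤ α}`). [cite: Clark2015EuclideanOrderTypes, Example 1.1] -/
theorem rank_Iic_ordinal_top (a : Ordinal.{u}) :
    IsWellFounded.rank (α := Set.Iic a) (· < ·) (⟨a, Set.self_mem_Iic⟩ : Set.Iic a) = lift.{u + 1} a := by
  rw [rank_subtype_eq_of_isLowerSet (isLowerSet_Iic a), rank_ordinal_eq_lift]

end LengthFunction

/-! ## §2 Brookfield's sum `len((α + 1) × (β + 1))` is `nadd` -/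

section Brookfield

/-- **The length function of `Ord × Ord` (product order) is the natural sum**: `λ(α, β) = α ⊕ β` — the tree's `nadd`,
defined by exactly this recursion, agrees with Mathlib's rank. [cite: Clark2015EuclideanOrderTypes, §1.2 (Brookfield sum) and
Thm. 2] -/
theorem rank_prod_eq_lift_nadd (a b : Ordinal.{u}) :
    IsWellFounded.rank (α := Ordinal.{u} × Ordinal.{u}) (· < ·) (a, b) = lift.{u + 1} (nadd a b) := by
  suffices H : ∀ p : Ordinal.{u} × Ordinal.{u}, IsWellFounded.rank (· < ·) p = lift.{u + 1} (nadd p.1 p.2) from H (a, b)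
  intro p
  induction p using WellFoundedLT.induction with
  | ind p ih =>
    obtain ⟨a, b⟩ := p
    rw [IsWellFounded.rank_eq]
    -- every term is below `lift (a ⊕ b)` by isotonicity of `⊕`
    have hle : (⨆ q : {q // q < (a, b)}, succ (IsWellFounded.rank (· < ·) q.1)) ≤ lift.{u + 1} (nadd a b) :=
      Ordinal.iSup_le fun q ↦ by
        rw [ih q.1 q.2]
        exact succ_le_of_lt (Ordinal.lift_lt.2 (nadd_strictMono q.2))
    refine le_antisymm hle ?_
    -- conversely the supremum is a lifted ordinal `c` with `a ⊕ b ≤ c` by the recursion for `⊕`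
    obtain ⟨c, -, hc⟩ := Ordinal.le_lift_iff.1 hle
    rw [← hc, Ordinal.lift_le, nadd_le_iff]
    constructor
    · intro a' ha'
      have hq : ((a', b) : Ordinal.{u} × Ordinal.{u}) < (a, b) := Prod.mk_lt_mk_iff_left.2 ha'
      rw [← Ordinal.lift_lt, hc, ← succ_le_iff, ← ih _ hq]
      exact Ordinal.le_iSup (fun q : {q // q < (a, b)} ↦ succ (IsWellFounded.rank (· < ·) q.1)) ⟨(a', b), hq⟩
    · intro b' hb'
      have hq : ((a, b') : Ordinal.{u} × Ordinal.{u}) < (a, b) := Prod.mk_lt_mk_iff_right.2 hb'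
      rw [← Ordinal.lift_lt, hc, ← succ_le_iff, ← ih _ hq]
      exact Ordinal.le_iSup (fun q : {q // q < (a, b)} ↦ succ (IsWellFounded.rank (· < ·) q.1)) ⟨(a, b'), hq⟩

/-- **Brookfield's definition `α ⊕_B β := len((α + 1) × (β + 1))`** holds for the tree's `nadd`: the length of the rectangle
`(α + 1) × (β + 1) = {(x, y) | x ≤ α, y ≤ β}` (its value at the top `(α, β)`) is `α ⊕ β`. [cite: Clark2015EuclideanOrderTypes,
§1.2 (Brookfield sum)] -/
theorem rank_Iic_prod_top (a b : Ordinal.{u}) :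
    IsWellFounded.rank (α := Set.Iic ((a, b) : Ordinal.{u} × Ordinal.{u})) (· < ·)
      (⟨(a, b), Set.self_mem_Iic⟩ : Set.Iic ((a, b) : Ordinal.{u} × Ordinal.{u})) = lift.{u + 1} (nadd a b) := by
  rw [rank_subtype_eq_of_isLowerSet (isLowerSet_Iic (a, b)), rank_prod_eq_lift_nadd]

/-- **Example 1.2 «`λ_X(i, j) = i + j`»** for `X = ℕ × ℕ` (hence for its rectangles `{0, …, m} × {0, …, n}`, down-sets of
`ℕ × ℕ`, and `len = m + n`). [cite: Clark2015EuclideanOrderTypes, Example 1.2] -/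
theorem rank_nat_prod (i j : ℕ) : IsWellFounded.rank (α := ℕ × ℕ) (· < ·) (i, j) = ((i + j : ℕ) : Ordinal.{0}) := by
  suffices H : ∀ p : ℕ × ℕ, IsWellFounded.rank (· < ·) p = ((p.1 + p.2 : ℕ) : Ordinal.{0}) from H (i, j)
  intro p
  induction p using WellFoundedLT.induction with
  | ind p ih =>
    obtain ⟨i, j⟩ := p
    rw [IsWellFounded.rank_eq]
    apply le_antisymm
    · refine Ordinal.iSup_le fun q ↦ ?_
      rw [ih q.1 q.2]
      have hlt : q.1.1 + q.1.2 < i + j := by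
        rcases Prod.lt_iff.1 q.2 with ⟨h₁, h₂⟩ | ⟨h₁, h₂⟩
        · exact Nat.add_lt_add_of_lt_of_le h₁ h₂
        · exact Nat.add_lt_add_of_le_of_lt h₁ h₂
      exact succ_le_of_lt (Nat.cast_lt.2 hlt)
    · rcases Nat.eq_zero_or_pos (i + j) with h0 | hpos
      · rw [show ((i, j) : ℕ × ℕ).1 + (i, j).2 = 0 from h0, Nat.cast_zero]
        exact bot_le
      · -- a coordinate is positive: its predecessor lies just below `(i, j)`
        obtain ⟨q, hq, hsum⟩ : ∃ q : ℕ × ℕ, q < (i, j) ∧ q.1 + q.2 + 1 = i + j := by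
          rcases Nat.eq_zero_or_pos i with hi | hi
          · exact ⟨(i, j - 1), Prod.mk_lt_mk_iff_right.2 (by omega), by dsimp; omega⟩
          · exact ⟨(i - 1, j), Prod.mk_lt_mk_iff_left.2 (by omega), by dsimp; omega⟩
        calc (((i, j) : ℕ × ℕ).1 + (i, j).2 : ℕ) = succ ((q.1 + q.2 : ℕ) : Ordinal.{0}) := by
              rw [succ_eq_add_one, ← Nat.cast_add_one, hsum]
          _ = succ (IsWellFounded.rank (· < ·) q) := by rw [ih q hq]
          _ ≤ _ := Ordinal.le_iSup (fun q : {q // q < (i, j)} ↦ succ (IsWellFounded.rank (· < ·) q.1)) ⟨q, hq⟩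

/-- Example 1.2, `len({0, …, m} × {0, …, n}) = m + n`: the rectangle is the down-set of `(m, n)` in `ℕ × ℕ`.
[cite: Clark2015EuclideanOrderTypes, Example 1.2] -/
theorem rank_Iic_nat_prod_top (m n : ℕ) :
    IsWellFounded.rank (α := Set.Iic ((m, n) : ℕ × ℕ)) (· < ·) (⟨(m, n), Set.self_mem_Iic⟩ : Set.Iic ((m, n) : ℕ × ℕ)) =
      ((m + n : ℕ) : Ordinal.{0}) := by
  rw [rank_subtype_eq_of_isLowerSet (isLowerSet_Iic (m, n)), rank_nat_prod]

end Brookfield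

/-! ## §3 Associativity of `⊕` -/

section Assoc

/-- **`(α ⊕ β) ⊕ γ = α ⊕ (β ⊕ γ)`**: the natural sum is associative (induction along the recursion in all three variables).
[cite: Clark2015EuclideanOrderTypes, §1.2 («the natural sum»; iterated sums `e(R₁) ⊕ … ⊕ e(R_n)` in Thm. 22 (b))] -/
theorem nadd_assoc (a b c : Ordinal.{u}) : nadd (nadd a b) c = nadd a (nadd b c) := by
  suffices H : ∀ p : Ordinal.{u} × Ordinal.{u} × Ordinal.{u},
      nadd (nadd p.1 p.2.1) p.2.2 = nadd p.1 (nadd p.2.1 p.2.2) from H (a, b, c)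
  intro p
  induction p using WellFoundedLT.induction with
  | ind p ih =>
    obtain ⟨a, b, c⟩ := p
    have iha : ∀ a' < a, nadd (nadd a' b) c = nadd a' (nadd b c) :=
      fun a' h ↦ ih (a', b, c) (Prod.mk_lt_mk_iff_left.2 h)
    have ihb : ∀ b' < b, nadd (nadd a b') c = nadd a (nadd b' c) :=
      fun b' h ↦ ih (a, b', c) (Prod.mk_lt_mk_iff_right.2 (Prod.mk_lt_mk_iff_left.2 h))
    have ihc : ∀ c' < c, nadd (nadd a b) c' = nadd a (nadd b c') :=
      fun c' h ↦ ih (a, b, c') (Prod.mk_lt_mk_iff_right.2 (Prod.mk_lt_mk_iff_right.2 h))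
    show nadd (nadd a b) c = nadd a (nadd b c)
    apply le_antisymm
    · rw [nadd_le_iff]
      refine ⟨fun d hd ↦ ?_, fun c' hc' ↦ ?_⟩
      · rcases lt_nadd_iff.1 hd with ⟨a', ha', hda⟩ | ⟨b', hb', hdb⟩
        · calc nadd d c ≤ nadd (nadd a' b) c := nadd_le_nadd_right hda c
            _ = nadd a' (nadd b c) := iha a' ha'
            _ < nadd a (nadd b c) := nadd_lt_nadd_right ha' _
        · calc nadd d c ≤ nadd (nadd a b') c := nadd_le_nadd_right hdb c
            _ = nadd a (nadd b' c) := ihb b' hb'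
            _ < nadd a (nadd b c) := nadd_lt_nadd_left (nadd_lt_nadd_right hb' c) a
      · calc nadd (nadd a b) c' = nadd a (nadd b c') := ihc c' hc'
          _ < nadd a (nadd b c) := nadd_lt_nadd_left (nadd_lt_nadd_left hc' b) a
    · rw [nadd_le_iff]
      refine ⟨fun a' ha' ↦ ?_, fun d hd ↦ ?_⟩
      · calc nadd a' (nadd b c) = nadd (nadd a' b) c := (iha a' ha').symm
          _ < nadd (nadd a b) c := nadd_lt_nadd_right (nadd_lt_nadd_right ha' b) c
      · rcases lt_nadd_iff.1 hd with ⟨b', hb', hdb⟩ | ⟨c', hc', hdc⟩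
        · calc nadd a d ≤ nadd a (nadd b' c) := nadd_le_nadd_left hdb a
            _ = nadd (nadd a b') c := (ihb b' hb').symm
            _ < nadd (nadd a b) c := nadd_lt_nadd_right (nadd_lt_nadd_left hb' a) c
        · calc nadd a d ≤ nadd a (nadd b c') := nadd_le_nadd_left hdc a
            _ = nadd (nadd a b) c' := (ihc c' hc').symm
            _ < nadd (nadd a b) c := nadd_lt_nadd_left hc' _

/-- `α ⊕ (β ⊕ γ) = β ⊕ (α ⊕ γ)`. [cite: Clark2015EuclideanOrderTypes, §1.2] -/
theorem nadd_left_comm (a b c : Ordinal.{u}) : nadd a (nadd b c) = nadd b (nadd a c) := by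
  rw [← nadd_assoc, nadd_comm a b, nadd_assoc]

/-- `(α ⊕ β) ⊕ γ = (α ⊕ γ) ⊕ β`. [cite: Clark2015EuclideanOrderTypes, §1.2] -/
theorem nadd_right_comm (a b c : Ordinal.{u}) : nadd (nadd a b) c = nadd (nadd a c) b := by
  rw [nadd_assoc, nadd_comm b c, ← nadd_assoc]

end Assoc

end Literature.Order.Ordinal
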